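import Summits.SmoothPoincare4.SmoothPoincare4.Theorems.SullivanDualTameOrBrodyR4StubGluingForms

/-!
# Stub `stub_gluing` of line `Sketch` for crux `TameOrBrodyR4` (stmt-SmoothPoincare4-7826, route SullivanDual)

**Asymptotic pull-back gluing** (step S6 of the anchored-pencils line, idea card
`Cruxes/TameOrBrodyR4/Ideas/anchored-pencils.md`, skeleton `Cruxes/TameOrBrodyR4/Lines/Sketch.lean`):
let `J` be an almost complex structure on `ℝ⁴` which is the standard `i` (`⟪J a, b⟫ = ω₀(a, b)`)
on `‖x‖ ≥ R`, and let `Φ : ℝ⁴ → ℝ⁴` be `C^∞` with `‖DΦ(x) - 1‖ → 0` as `x → ∞`, `Φ - id`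
bounded, and `Φ^*ω₀` taming `J` (`ω₀(DΦ v, DΦ Jv) > 0` for `v ≠ 0`). Then there is a closed
`C^∞` `2`-form `sf`, equal to `ω₀` outside a ball, taming `J` everywhere.

Proof (fully formal below). With the Liouville form `λ₀(x) = ½ ω₀(x, ·)` (`dλ₀ = ω₀`,
`extDeriv_liouville`) and the pulled-back form `θ = Φ^*λ₀` (`dθ = Φ^*ω₀`, Mathlib's
`extDeriv_pullback`), put `β = θ - λ₀` and `η = θ - χ_ρ • β` for the radial cut-off
`χ_ρ(x) = ψ((‖x‖²/ρ² - 1)/3)`, `ψ = Real.smoothTransition` (`χ_ρ = 0` on `‖x‖ ≤ ρ`, `= 1` on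
`‖x‖ ≥ 2ρ`, `|dχ_ρ| ≤ 4K/(3ρ)` with `K = sup_[0,1] |ψ'|`). Then `sf := dη` is `C^∞`, closed
(`d ∘ d = 0`, Mathlib's `extDeriv_extDeriv`), equals `dλ₀ = ω₀` where `χ_ρ ≡ 1`, equals
`dθ = Φ^*ω₀` where `χ_ρ ≡ 0`, and on the annulus `ρ ≤ ‖x‖ ≤ 2ρ` (where `J = i =: J₀`)
`sf(v, J₀v) = (1-χ) ω₀(DΦ v, DΦ J₀ v) + χ ‖v‖² - (dχ(v) β(J₀v) - dχ(J₀v) β(v))`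
`≥ (1 - 3ε) ‖v‖² - 2 (K₁C/ρ + K₁ε) ‖v‖² ≥ ‖v‖²/4`, using `‖DΦ - 1‖ ≤ ε` beyond `ρ₀`,
`|β_x(w)| ≤ ½(‖Φ x - x‖ ‖DΦ w‖ + ‖x‖ ‖(DΦ - 1) w‖) ≤ (C + ρε)‖w‖`, with the constants
`K₁ = 4K/3`, `ε = 1/(2(3 + 2K₁))`, `ρ = max(R, ρ₀, 8K₁C + 1)`.

The auxiliary definitions (`J0`, `oneForm`, `liouvilleCLM`, `liouville`, `pullLiouville`,
`cutArg`, `cutoff`, namespace `…Sketch.Gluing`) live in the sibling helper file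
`SullivanDualTameOrBrodyR4StubGluingForms.lean`; they are proof-internal gadgets (the standard
complex structure, the Liouville form and its pull-back, the cut-off), not objects the route
posits. References: McDuff–Salamon, *Introduction to Symplectic Topology* (3rd ed. 2017),
§1.1 (ω₀, λ₀); the gluing is the elementary last step of Gromov's argument as in Wendl,
*Holomorphic Curves in Low Dimensions*, proof of Thm 6.8.
-/

noncomputable section

open scoped ContDiff Topology InnerProductSpace
open Filter Set Metric Literature.Geometry.Symplectic
open Summit.SmoothPoincare4.SmoothPoincare4.Theorems.GromovRecognitionRelEnd.CrossCapLaurent.FlatCutoff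
  (abs_stdSymplecticForm_le)

-- the registered namespace `Summit.SmoothPoincare4.SmoothPoincare4.Theorems` repeats a component
set_option linter.dupNamespace false

namespace Summit.SmoothPoincare4.SmoothPoincare4.Cruxes.TameOrBrodyR4.Sketch.Gluing

/-! ### Pointwise linear estimates -/

/-- `ω₀` is additive in the first slot. -/
theorem stdSymplecticForm_add_left (a b c : (EuclideanSpace ℝ (Fin 4))) :
    stdSymplecticForm (a + b) c = stdSymplecticForm a c + stdSymplecticForm b c := by
  simp only [stdSymplecticForm, PiLp.add_apply]; ring

/-- `ω₀` is additive in the second slot. -/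
theorem stdSymplecticForm_add_right (a b c : (EuclideanSpace ℝ (Fin 4))) :
    stdSymplecticForm a (b + c) = stdSymplecticForm a b + stdSymplecticForm a c := by
  simp only [stdSymplecticForm, PiLp.add_apply]; ring

/-- `ω₀` respects subtraction in the first slot. -/
theorem stdSymplecticForm_sub_left (a b c : (EuclideanSpace ℝ (Fin 4))) :
    stdSymplecticForm (a - b) c = stdSymplecticForm a c - stdSymplecticForm b c := by
  simp only [stdSymplecticForm, PiLp.sub_apply]; ring

/-- `ω₀` respects subtraction in the second slot. -/
theorem stdSymplecticForm_sub_right (a b c : (EuclideanSpace ℝ (Fin 4))) :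
    stdSymplecticForm a (b - c) = stdSymplecticForm a b - stdSymplecticForm a c := by
  simp only [stdSymplecticForm, PiLp.sub_apply]; ring

/-- If `‖A - 1‖ ≤ ε ≤ 1` then `ω₀(A v, A J₀ v) ≥ (1 - 3ε) ‖v‖²`. -/
theorem taming_of_near_id {A : (EuclideanSpace ℝ (Fin 4)) →L[ℝ] (EuclideanSpace ℝ (Fin 4))} {ε : ℝ} (hε0 : 0 ≤ ε) (hε1 : ε ≤ 1)
    (hA : ‖A - ContinuousLinearMap.id ℝ (EuclideanSpace ℝ (Fin 4))‖ ≤ ε) (v : (EuclideanSpace ℝ (Fin 4))) :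
    (1 - 3 * ε) * ‖v‖ ^ 2 ≤ stdSymplecticForm (A v) (A (J0 v)) := by
  set B := A - ContinuousLinearMap.id ℝ (EuclideanSpace ℝ (Fin 4)) with hB
  have hAv : A v = B v + v := by simp [hB]
  have hAJ : A (J0 v) = B (J0 v) + J0 v := by simp [hB]
  have hBv : ‖B v‖ ≤ ε * ‖v‖ := (B.le_opNorm v).trans (mul_le_mul_of_nonneg_right hA (norm_nonneg _))
  have hBJ : ‖B (J0 v)‖ ≤ ε * ‖v‖ := by
    have := (B.le_opNorm (J0 v)).trans (mul_le_mul_of_nonneg_right hA (norm_nonneg _))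
    rwa [norm_J0] at this
  rw [hAv, hAJ, stdSymplecticForm_add_left, stdSymplecticForm_add_right,
    stdSymplecticForm_add_right, stdSymplecticForm_J0]
  have e1 : |stdSymplecticForm (B v) (B (J0 v))| ≤ ε * ‖v‖ ^ 2 := by
    refine (abs_stdSymplecticForm_le _ _).trans ?_
    calc ‖B v‖ * ‖B (J0 v)‖ ≤ (ε * ‖v‖) * (ε * ‖v‖) :=
          mul_le_mul hBv hBJ (norm_nonneg _) (by positivity)
      _ = ε * ε * ‖v‖ ^ 2 := by ring
      _ ≤ 1 * ε * ‖v‖ ^ 2 := by gcongr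
      _ = ε * ‖v‖ ^ 2 := by ring
  have e2 : |stdSymplecticForm (B v) (J0 v)| ≤ ε * ‖v‖ ^ 2 := by
    refine (abs_stdSymplecticForm_le _ _).trans ?_
    rw [norm_J0]
    calc ‖B v‖ * ‖v‖ ≤ (ε * ‖v‖) * ‖v‖ := mul_le_mul_of_nonneg_right hBv (norm_nonneg _)
      _ = ε * ‖v‖ ^ 2 := by ring
  have e3 : |stdSymplecticForm v (B (J0 v))| ≤ ε * ‖v‖ ^ 2 := by
    refine (abs_stdSymplecticForm_le _ _).trans ?_
    calc ‖v‖ * ‖B (J0 v)‖ ≤ ‖v‖ * (ε * ‖v‖) := mul_le_mul_of_nonneg_left hBJ (norm_nonneg _)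
      _ = ε * ‖v‖ ^ 2 := by ring
  have a1 := neg_abs_le (stdSymplecticForm (B v) (B (J0 v)))
  have a2 := neg_abs_le (stdSymplecticForm (B v) (J0 v))
  have a3 := neg_abs_le (stdSymplecticForm v (B (J0 v)))
  linarith

/-- The primitive `β = Φ^*λ₀ - λ₀` in terms of `Φ x - x` and `DΦ - 1`. -/
theorem pullLiouville_sub_liouville_apply (Φ : (EuclideanSpace ℝ (Fin 4)) → (EuclideanSpace ℝ (Fin 4))) (x w : (EuclideanSpace ℝ (Fin 4))) :
    pullLiouville Φ x ![w] - liouville x ![w] =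
      1 / 2 * (stdSymplecticForm (Φ x - x) (fderiv ℝ Φ x w) +
        stdSymplecticForm x (fderiv ℝ Φ x w - w)) := by
  rw [pullLiouville_apply, liouville_apply, stdSymplecticForm_sub_left, stdSymplecticForm_sub_right]
  simp only [Matrix.cons_val_zero]
  ring

/-- Bound for the primitive: `|β_x(w)| ≤ ½ (‖Φ x - x‖ ‖DΦ w‖ + ‖x‖ ‖(DΦ - 1) w‖)`. -/
theorem abs_pullLiouville_sub_liouville_le (Φ : (EuclideanSpace ℝ (Fin 4)) → (EuclideanSpace ℝ (Fin 4))) (x w : (EuclideanSpace ℝ (Fin 4))) :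
    |pullLiouville Φ x ![w] - liouville x ![w]| ≤
      1 / 2 * (‖Φ x - x‖ * ‖fderiv ℝ Φ x w‖ +
        ‖x‖ * ‖(fderiv ℝ Φ x - ContinuousLinearMap.id ℝ (EuclideanSpace ℝ (Fin 4))) w‖) := by
  rw [pullLiouville_sub_liouville_apply, abs_mul, abs_of_pos (by norm_num : (0 : ℝ) < 1 / 2)]
  refine mul_le_mul_of_nonneg_left ((abs_add_le _ _).trans (add_le_add
    (abs_stdSymplecticForm_le _ _) ?_)) (by norm_num)
  have : fderiv ℝ Φ x w - w = (fderiv ℝ Φ x - ContinuousLinearMap.id ℝ (EuclideanSpace ℝ (Fin 4))) w := by simp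
  rw [this]
  exact abs_stdSymplecticForm_le _ _

/-- From `DΦ → 1` at infinity: a radius beyond which `‖DΦ - 1‖ ≤ ε`. -/
theorem exists_radius_of_tendsto {Φ : (EuclideanSpace ℝ (Fin 4)) → (EuclideanSpace ℝ (Fin 4))}
    (hD : Tendsto (fun x => ‖fderiv ℝ Φ x - ContinuousLinearMap.id ℝ (EuclideanSpace ℝ (Fin 4))‖) (cocompact (EuclideanSpace ℝ (Fin 4))) (𝓝 0))
    {ε : ℝ} (hε : 0 < ε) :
    ∃ ρ₀ : ℝ, ∀ x : (EuclideanSpace ℝ (Fin 4)), ρ₀ ≤ ‖x‖ → ‖fderiv ℝ Φ x - ContinuousLinearMap.id ℝ (EuclideanSpace ℝ (Fin 4))‖ ≤ ε := by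
  have hev : ∀ᶠ x in cocompact (EuclideanSpace ℝ (Fin 4)), ‖fderiv ℝ Φ x - ContinuousLinearMap.id ℝ (EuclideanSpace ℝ (Fin 4))‖ < ε := by
    have h := (Metric.tendsto_nhds.1 hD) ε hε
    filter_upwards [h] with x hx
    simpa [Real.dist_eq] using hx
  obtain ⟨Kc, hKc, hKc'⟩ := Filter.hasBasis_cocompact.eventually_iff.1 hev
  obtain ⟨r, hr⟩ := hKc.isBounded.subset_closedBall 0
  refine ⟨r + 1, fun x hx => le_of_lt (hKc' ?_)⟩
  intro hxK
  have := hr hxK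
  rw [Metric.mem_closedBall, dist_zero_right] at this
  linarith


/-! ### The gluing theorem -/

/-- **Asymptotic pull-back gluing** (the content of stub S6 of line `Sketch` / idea `anchored-pencils`): if
`Φ : ℝ⁴ → ℝ⁴` is `C^∞` with `DΦ → 1` at infinity and `Φ - id` bounded, and `Φ^*ω₀` tames `J`,
where `J = i` outside the ball of radius `R`, then some closed `C^∞` `2`-form equal to `ω₀`
outside a larger ball tames `J` everywhere. The form is `d(Φ^*λ₀ - χ_ρ (Φ^*λ₀ - λ₀))` for `ρ`
large. -/
theorem asymptoticPullbackGluing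
    (J : (EuclideanSpace ℝ (Fin 4)) → (EuclideanSpace ℝ (Fin 4)) →L[ℝ] (EuclideanSpace ℝ (Fin 4))) (R : ℝ) (hR : 0 < R)
    (hJi : ∀ x : (EuclideanSpace ℝ (Fin 4)), R ≤ ‖x‖ → ∀ a b : (EuclideanSpace ℝ (Fin 4)), ⟪J x a, b⟫_ℝ = stdSymplecticForm a b)
    (Φ : (EuclideanSpace ℝ (Fin 4)) → (EuclideanSpace ℝ (Fin 4))) (hΦ : ContDiff ℝ ∞ Φ)
    (hD : Tendsto (fun x => ‖fderiv ℝ Φ x - ContinuousLinearMap.id ℝ (EuclideanSpace ℝ (Fin 4))‖) (cocompact (EuclideanSpace ℝ (Fin 4))) (𝓝 0))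
    (hC : ∃ C : ℝ, ∀ x, ‖Φ x - x‖ ≤ C)
    (hpos : ∀ x v : (EuclideanSpace ℝ (Fin 4)), v ≠ 0 → 0 < stdSymplecticForm (fderiv ℝ Φ x v) (fderiv ℝ Φ x (J x v))) :
    ∃ (R' : ℝ) (sf : (EuclideanSpace ℝ (Fin 4)) → (EuclideanSpace ℝ (Fin 4)) [⋀^Fin 2]→L[ℝ] ℝ), ContDiff ℝ ∞ sf ∧ extDeriv sf = 0 ∧
      (∀ x : (EuclideanSpace ℝ (Fin 4)), R' ≤ ‖x‖ → ∀ a b : (EuclideanSpace ℝ (Fin 4)), sf x ![a, b] = stdSymplecticForm a b) ∧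
      ∀ x v : (EuclideanSpace ℝ (Fin 4)), v ≠ 0 → 0 < sf x ![v, J x v] := by
  obtain ⟨C, hC⟩ := hC
  have hC0 : 0 ≤ C := le_trans (norm_nonneg _) (hC 0)
  obtain ⟨K, hK0, hK⟩ := exists_bound_deriv_smoothTransition
  -- constants
  set K₁ : ℝ := 4 * K / 3 with hK₁
  have hK₁0 : 0 ≤ K₁ := by positivity
  set ε : ℝ := 1 / (2 * (3 + 2 * K₁)) with hε
  have hε0 : 0 < ε := by positivity
  have hεK : (3 + 2 * K₁) * ε = 1 / 2 := by
    rw [hε]; field_simp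
  have hε1 : ε ≤ 1 := by
    have : (1 : ℝ) ≤ 2 * (3 + 2 * K₁) := by nlinarith
    rw [hε, div_le_one (by positivity)]; exact this
  obtain ⟨ρ₀, hρ₀⟩ := exists_radius_of_tendsto hD hε0
  set ρ : ℝ := max (max R ρ₀) (8 * K₁ * C + 1) with hρdef
  have hρR : R ≤ ρ := (le_max_left _ _).trans (le_max_left _ _)
  have hρ₀' : ρ₀ ≤ ρ := (le_max_right _ _).trans (le_max_left _ _)
  have hρC : 8 * K₁ * C + 1 ≤ ρ := le_max_right _ _
  have hρ0 : 0 < ρ := hR.trans_le hρR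
  -- the forms
  set χ : (EuclideanSpace ℝ (Fin 4)) → ℝ := cutoff ρ with hχdef
  set θ : (EuclideanSpace ℝ (Fin 4)) → (EuclideanSpace ℝ (Fin 4)) [⋀^Fin 1]→L[ℝ] ℝ := pullLiouville Φ with hθdef
  set β : (EuclideanSpace ℝ (Fin 4)) → (EuclideanSpace ℝ (Fin 4)) [⋀^Fin 1]→L[ℝ] ℝ := fun x => θ x - liouville x with hβdef
  set η : (EuclideanSpace ℝ (Fin 4)) → (EuclideanSpace ℝ (Fin 4)) [⋀^Fin 1]→L[ℝ] ℝ := fun x => θ x - χ x • β x with hηdef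
  have hθ : ContDiff ℝ ∞ θ := contDiff_pullLiouville hΦ
  have hβ : ContDiff ℝ ∞ β := hθ.sub contDiff_liouville
  have hχ : ContDiff ℝ ∞ χ := contDiff_cutoff ρ
  have hχβ : ContDiff ℝ ∞ (fun x => χ x • β x) := hχ.smul hβ
  have hη : ContDiff ℝ ∞ η := hθ.sub hχβ
  have hdiff : ∀ {f : (EuclideanSpace ℝ (Fin 4)) → (EuclideanSpace ℝ (Fin 4)) [⋀^Fin 1]→L[ℝ] ℝ}, ContDiff ℝ ∞ f → ∀ x, DifferentiableAt ℝ f x :=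
    fun hf x => (hf.differentiable (by simp)).differentiableAt
  -- J is standard outside `R`
  have hJ0 : ∀ x : (EuclideanSpace ℝ (Fin 4)), R ≤ ‖x‖ → J x = J0 := fun x hx => eq_J0_of_inner_eq (hJi x hx)
  have hmin : minSmoothness ℝ 2 ≤ ∞ := by
    rw [minSmoothness_of_isRCLikeNormedField]; exact WithTop.coe_le_coe.2 le_top
  refine ⟨2 * ρ + 1, extDeriv η, contDiff_extDeriv' hη, extDeriv_extDeriv hη hmin, ?_, ?_⟩
  · -- standard beyond `2ρ + 1`
    intro x hx a b
    have hx' : 2 * ρ < ‖x‖ := by linarith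
    have hloc : η =ᶠ[𝓝 x] liouville := by
      filter_upwards [cutoff_eventuallyEq_one hρ0 hx'] with y hy
      simp only [hηdef, hβdef, hχdef, hy, one_smul, sub_sub_cancel]
    rw [hloc.extDeriv_eq, extDeriv_liouville_apply]
  · -- taming
    intro x v hv
    have hnv : 0 < ‖v‖ ^ 2 := by positivity
    by_cases h1 : ‖x‖ < ρ
    · -- inside: `η = θ` near `x`, `dθ = Φ^*ω₀`
      have hloc : η =ᶠ[𝓝 x] θ := by
        filter_upwards [cutoff_eventuallyEq_zero hρ0 h1] with y hy
        simp only [hηdef, hχdef, hy, zero_smul, sub_zero]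
      rw [hloc.extDeriv_eq, hθdef, extDeriv_pullLiouville_apply hΦ]
      exact hpos x v hv
    push Not at h1
    have hxR : R ≤ ‖x‖ := hρR.trans h1
    rw [hJ0 x hxR]
    by_cases h2 : 2 * ρ < ‖x‖
    · -- far outside: `η = λ₀` near `x`
      have hloc : η =ᶠ[𝓝 x] liouville := by
        filter_upwards [cutoff_eventuallyEq_one hρ0 h2] with y hy
        simp only [hηdef, hβdef, hχdef, hy, one_smul, sub_sub_cancel]
      rw [hloc.extDeriv_eq, extDeriv_liouville_apply, stdSymplecticForm_J0]
      exact hnv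
    push Not at h2
    -- the annulus `ρ ≤ ‖x‖ ≤ 2ρ`: explicit formula
    set A := fderiv ℝ Φ x with hA
    have hAε : ‖A - ContinuousLinearMap.id ℝ (EuclideanSpace ℝ (Fin 4))‖ ≤ ε := hρ₀ x (hρ₀'.trans h1)
    have formula : ∀ w : (EuclideanSpace ℝ (Fin 4)), extDeriv η x ![v, w] =
        stdSymplecticForm (A v) (A w) -
          (χ x * (stdSymplecticForm (A v) (A w) - stdSymplecticForm v w) +
            (fderiv ℝ χ x v * β x ![w] - fderiv ℝ χ x w * β x ![v])) := by
      intro w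
      rw [hηdef, extDeriv_sub_one_apply (hdiff hθ x) (hdiff hχβ x),
        extDeriv_smul_one_apply ((hχ.differentiable (by simp)) x) (hdiff hβ x),
        hβdef, extDeriv_sub_one_apply (hdiff hθ x) (differentiable_liouville x), hθdef,
        extDeriv_pullLiouville_apply hΦ, extDeriv_liouville_apply]
    rw [formula (J0 v), stdSymplecticForm_J0]
    -- the estimates
    have main : (1 - 3 * ε) * ‖v‖ ^ 2 ≤ stdSymplecticForm (A v) (A (J0 v)) :=
      taming_of_near_id hε0.le hε1 hAε v
    have hχ0 : 0 ≤ χ x := cutoff_nonneg ρ x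
    have hχ1 : χ x ≤ 1 := cutoff_le_one ρ x
    have hd1 : |fderiv ℝ χ x v| ≤ K₁ / ρ * ‖v‖ := by
      have := abs_fderiv_cutoff_le hK0 hK hρ0 h1 h2 v
      rw [hK₁]; convert this using 1; ring
    have hd2 : |fderiv ℝ χ x (J0 v)| ≤ K₁ / ρ * ‖v‖ := by
      have := abs_fderiv_cutoff_le hK0 hK hρ0 h1 h2 (J0 v)
      rw [norm_J0] at this
      rw [hK₁]; convert this using 1; ring
    have hAw : ∀ w : (EuclideanSpace ℝ (Fin 4)), ‖A w‖ ≤ 2 * ‖w‖ := by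
      intro w
      have h' : A w = (A - ContinuousLinearMap.id ℝ (EuclideanSpace ℝ (Fin 4))) w + w := by simp
      have h'' : ‖(A - ContinuousLinearMap.id ℝ (EuclideanSpace ℝ (Fin 4))) w‖ ≤ ε * ‖w‖ :=
        ((A - ContinuousLinearMap.id ℝ (EuclideanSpace ℝ (Fin 4))).le_opNorm w).trans
          (mul_le_mul_of_nonneg_right hAε (norm_nonneg _))
      calc ‖A w‖ = ‖(A - ContinuousLinearMap.id ℝ (EuclideanSpace ℝ (Fin 4))) w + w‖ := by rw [← h']
        _ ≤ ‖(A - ContinuousLinearMap.id ℝ (EuclideanSpace ℝ (Fin 4))) w‖ + ‖w‖ := norm_add_le _ _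
        _ ≤ ε * ‖w‖ + ‖w‖ := by linarith
        _ ≤ 2 * ‖w‖ := by nlinarith [norm_nonneg w]
    have hβw : ∀ w : (EuclideanSpace ℝ (Fin 4)), |β x ![w]| ≤ (C + ρ * ε) * ‖w‖ := by
      intro w
      have hb := abs_pullLiouville_sub_liouville_le Φ x w
      have h'' : ‖(A - ContinuousLinearMap.id ℝ (EuclideanSpace ℝ (Fin 4))) w‖ ≤ ε * ‖w‖ :=
        ((A - ContinuousLinearMap.id ℝ (EuclideanSpace ℝ (Fin 4))).le_opNorm w).trans
          (mul_le_mul_of_nonneg_right hAε (norm_nonneg _))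
      have hΦx : ‖Φ x - x‖ ≤ C := hC x
      have e1 : ‖Φ x - x‖ * ‖fderiv ℝ Φ x w‖ ≤ C * (2 * ‖w‖) :=
        mul_le_mul hΦx (hAw w) (norm_nonneg _) hC0
      have e2 : ‖x‖ * ‖(fderiv ℝ Φ x - ContinuousLinearMap.id ℝ (EuclideanSpace ℝ (Fin 4))) w‖ ≤ (2 * ρ) * (ε * ‖w‖) :=
        mul_le_mul h2 h'' (norm_nonneg _) (by positivity)
      have : β x ![w] = pullLiouville Φ x ![w] - liouville x ![w] := rfl
      rw [this]
      calc |pullLiouville Φ x ![w] - liouville x ![w]|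
          ≤ 1 / 2 * (‖Φ x - x‖ * ‖fderiv ℝ Φ x w‖ +
              ‖x‖ * ‖(fderiv ℝ Φ x - ContinuousLinearMap.id ℝ (EuclideanSpace ℝ (Fin 4))) w‖) := hb
        _ ≤ 1 / 2 * (C * (2 * ‖w‖) + (2 * ρ) * (ε * ‖w‖)) := by gcongr
        _ = (C + ρ * ε) * ‖w‖ := by ring
    have hb1 := hβw (J0 v)
    rw [norm_J0] at hb1
    have hb2 := hβw v
    -- products
    have p1 : |fderiv ℝ χ x v * β x ![J0 v]| ≤ (K₁ / ρ * ‖v‖) * ((C + ρ * ε) * ‖v‖) := by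
      rw [abs_mul]; exact mul_le_mul hd1 hb1 (abs_nonneg _) (by positivity)
    have p2 : |fderiv ℝ χ x (J0 v) * β x ![v]| ≤ (K₁ / ρ * ‖v‖) * ((C + ρ * ε) * ‖v‖) := by
      rw [abs_mul]; exact mul_le_mul hd2 hb2 (abs_nonneg _) (by positivity)
    have q1 := neg_abs_le (fderiv ℝ χ x v * β x ![J0 v])
    have q1' := le_abs_self (fderiv ℝ χ x v * β x ![J0 v])
    have q2 := neg_abs_le (fderiv ℝ χ x (J0 v) * β x ![v])
    have q2' := le_abs_self (fderiv ℝ χ x (J0 v) * β x ![v])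
    -- `2 K₁ C / ρ ≤ 1/4`
    have hρ1 : K₁ / ρ * (C + ρ * ε) = K₁ * C / ρ + K₁ * ε := by
      field_simp
    have hKC : K₁ * C / ρ ≤ 1 / 8 := by
      rw [div_le_iff₀ hρ0]
      nlinarith [mul_nonneg hK₁0 hC0]
    have prod : (K₁ / ρ * ‖v‖) * ((C + ρ * ε) * ‖v‖) = (K₁ * C / ρ + K₁ * ε) * ‖v‖ ^ 2 := by
      rw [← hρ1]; ring
    rw [prod] at p1 p2
    -- convexity in `χ`
    have cvx : (1 - 3 * ε) * ‖v‖ ^ 2 ≤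
        (1 - χ x) * stdSymplecticForm (A v) (A (J0 v)) + χ x * ‖v‖ ^ 2 := by
      have t0 : (1 - 3 * ε) * ‖v‖ ^ 2 ≤ ‖v‖ ^ 2 := by
        have : 0 ≤ 3 * ε * ‖v‖ ^ 2 := by positivity
        linarith
      calc (1 - 3 * ε) * ‖v‖ ^ 2
          = (1 - χ x) * ((1 - 3 * ε) * ‖v‖ ^ 2) + χ x * ((1 - 3 * ε) * ‖v‖ ^ 2) := by ring
        _ ≤ (1 - χ x) * stdSymplecticForm (A v) (A (J0 v)) + χ x * ‖v‖ ^ 2 :=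
          add_le_add (mul_le_mul_of_nonneg_left main (sub_nonneg.2 hχ1))
            (mul_le_mul_of_nonneg_left t0 hχ0)
    have eq : stdSymplecticForm (A v) (A (J0 v)) -
        (χ x * (stdSymplecticForm (A v) (A (J0 v)) - ‖v‖ ^ 2) +
          (fderiv ℝ χ x v * β x ![J0 v] - fderiv ℝ χ x (J0 v) * β x ![v])) =
        ((1 - χ x) * stdSymplecticForm (A v) (A (J0 v)) + χ x * ‖v‖ ^ 2) -
          fderiv ℝ χ x v * β x ![J0 v] + fderiv ℝ χ x (J0 v) * β x ![v] := by ring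
    have total : (1 - 3 * ε) * ‖v‖ ^ 2 - 2 * ((K₁ * C / ρ + K₁ * ε) * ‖v‖ ^ 2) ≤
        stdSymplecticForm (A v) (A (J0 v)) -
          (χ x * (stdSymplecticForm (A v) (A (J0 v)) - ‖v‖ ^ 2) +
            (fderiv ℝ χ x v * β x ![J0 v] - fderiv ℝ χ x (J0 v) * β x ![v])) := by
      rw [eq]
      linarith [cvx, p1, p2, q1', q2]
    have pos : 0 < (1 - 3 * ε) * ‖v‖ ^ 2 - 2 * ((K₁ * C / ρ + K₁ * ε) * ‖v‖ ^ 2) := by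
      have e : (1 - 3 * ε) * ‖v‖ ^ 2 - 2 * ((K₁ * C / ρ + K₁ * ε) * ‖v‖ ^ 2) =
          (1 - (3 + 2 * K₁) * ε - 2 * (K₁ * C / ρ)) * ‖v‖ ^ 2 := by ring
      rw [e, hεK]
      have : (0 : ℝ) < 1 - 1 / 2 - 2 * (K₁ * C / ρ) := by linarith [hKC]
      exact mul_pos this hnv
    exact lt_of_lt_of_le pos total

end Summit.SmoothPoincare4.SmoothPoincare4.Cruxes.TameOrBrodyR4.Sketch.Gluing

namespace Summit.SmoothPoincare4.SmoothPoincare4.Cruxes.TameOrBrodyR4.Sketch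

/-- **Registered stub `stub_gluing` (S6) of line `Sketch`, crux `TameOrBrodyR4`.** If `Φ` is `C^∞`
with `DΦ → 1` at infinity, `Φ - id` bounded and `Φ^*ω₀` taming `J` (`J = i` on `‖x‖ ≥ R`), then
some closed `C^∞` `2`-form equal to `ω₀` outside a larger ball tames `J`
(`Gluing.asymptoticPullbackGluing`). -/
theorem stub_gluing (J : (EuclideanSpace ℝ (Fin 4)) → (EuclideanSpace ℝ (Fin 4)) →L[ℝ] (EuclideanSpace ℝ (Fin 4))) (R : ℝ) (hR : 0 < R)
    (hJi : ∀ x : (EuclideanSpace ℝ (Fin 4)), R ≤ ‖x‖ → ∀ a b : (EuclideanSpace ℝ (Fin 4)), ⟪J x a, b⟫_ℝ = stdSymplecticForm a b)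
    (Φ : (EuclideanSpace ℝ (Fin 4)) → (EuclideanSpace ℝ (Fin 4))) (hΦ : ContDiff ℝ ∞ Φ)
    (hD : Tendsto (fun x => ‖fderiv ℝ Φ x - ContinuousLinearMap.id ℝ (EuclideanSpace ℝ (Fin 4))‖) (cocompact (EuclideanSpace ℝ (Fin 4))) (𝓝 0))
    (hC : ∃ C : ℝ, ∀ x, ‖Φ x - x‖ ≤ C)
    (hpos : ∀ x v : (EuclideanSpace ℝ (Fin 4)), v ≠ 0 → 0 < stdSymplecticForm (fderiv ℝ Φ x v) (fderiv ℝ Φ x (J x v))) :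
    ∃ (R' : ℝ) (sf : (EuclideanSpace ℝ (Fin 4)) → (EuclideanSpace ℝ (Fin 4)) [⋀^Fin 2]→L[ℝ] ℝ), ContDiff ℝ ∞ sf ∧ extDeriv sf = 0 ∧
      (∀ x : (EuclideanSpace ℝ (Fin 4)), R' ≤ ‖x‖ → ∀ a b : (EuclideanSpace ℝ (Fin 4)), sf x ![a, b] = stdSymplecticForm a b) ∧
      ∀ x v : (EuclideanSpace ℝ (Fin 4)), v ≠ 0 → 0 < sf x ![v, J x v] :=
  Gluing.asymptoticPullbackGluing J R hR hJi Φ hΦ hD hC hpos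

end Summit.SmoothPoincare4.SmoothPoincare4.Cruxes.TameOrBrodyR4.Sketch
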